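import Literature.Geometry.Symplectic.SurfaceRoundTube
import HarnessLib

/-!
# The fibre scaling of the tube of a symplectic surface

Topic `Literature/Geometry/Symplectic`; layer C3b of the construction of the symplectic tubular
neighbourhood with its `U(1)`-structure of a closed symplectic surface `b : S → N` in a
symplectic `4`-manifold (McLean, GAFA 2012, **Lemma 5.14**, `k = 1`), for the fact seat of
`Literature.Geometry.Symplectic.mclean_divisorComplement_convex_four`.

With the embedded tube domain `N₃`, `Θ = (π₁, nrm)` and its inverse `Λ` (`SurfaceRoundTube.lean`)
we define the **fibre scaling** `Sc (x, σ) = Λ (π₁ x, σ • nrm x)` — the linear homotopy of the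
tube onto the surface along the fibres, the input of the relative Poincaré lemma of the Moser
argument (McDuff–Salamon 2017, Lemma 3.2.1 / Thm. 3.4.10):

* on the quarter tube `Tq = T (εc / 4)` and for `σ ∈ Jσ = (-3/2, 3/2)` it stays in `N₃` with
  `Θ (Sc (x, σ)) = (π₁ x, σ • nrm x)` (`Sc_spec`), `Sc (x, 1) = x`, `Sc (x, 0) = b (π₁ x)`,
  `Sc (b y, σ) = b y`, `ρ2 (Sc (x, σ)) = σ² ρ2 x`;
* in a box chart it is `(q, z) ↦ (q, σ z)` (`Sc_eq_inv`), hence **smooth** on `Tq × Jσ` for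
  the product model `(𝓡 4).prod 𝓘(ℝ, ℝ)` (`contMDiffOn_Sc`);
* its vertical derivative vanishes along the surface (`mfderiv_Sc_b_vertical`) and
  `x ↦ Sc (x, 1)` has identity differential on `N₃` (`mfderiv_Sc_one`).

Everything here is proved; no named facts (D-0026).

## References

* M. McLean, *The growth rate of symplectic homology and affine varieties*, GAFA 22 (2012),
  Lemma 5.14, pp. 35–37 (arXiv:1011.2542). [Mclean2012]
* D. McDuff, D. Salamon, *Introduction to Symplectic Topology*, 3rd ed. (2017), Lemma 3.2.1,
  Thm. 3.4.10. [McDuffSalamon2017]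
-/

noncomputable section

open scoped Manifold ContDiff Topology RealInnerProductSpace
open Set Function Module Filter Metric
open Literature.Topology.FourManifolds
open Literature.Geometry.Kaehler
open Literature.Geometry.Manifold

namespace Literature.Geometry.Symplectic

namespace SurfaceTube

/-- Local notation for the model plane. -/
local notation "E2" => EuclideanSpace ℝ (Fin 2)

variable {N : Type*} [TopologicalSpace N] [ChartedSpace (EuclideanSpace ℝ (Fin 4)) N]
  [IsManifold (𝓡 4) ∞ N] {S : Type*} [TopologicalSpace S] [ChartedSpace (EuclideanSpace ℝ (Fin 2)) S]
  [IsManifold (𝓡 2) ∞ S] {V : Type*} [NormedAddCommGroup V] [InnerProductSpace ℝ V]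
  [FiniteDimensional ℝ V] (D : Setup N S V)

namespace Setup

variable [CompactSpace S] [Nonempty S] [T2Space S]

/-! ### The quarter tube and the scaling interval -/

/-- **The quarter tube** `Tq = T (εc / 4)`: there `‖nrm‖ < ρ0 / 2`. [folklore] -/
def Tq : Set N := D.T (D.εc / 4)

/-- **The scaling interval** `Jσ = (-3/2, 3/2)` (open, star-shaped at `0`, contains `[0, 1]`).
[folklore] -/
def Jσ : Set ℝ := Ioo (-(3 / 2 : ℝ)) (3 / 2)

/-- `Tq` is open. [folklore] -/
theorem isOpen_Tq : IsOpen D.Tq := D.isOpen_T _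

/-- `Jσ` is open. [folklore] -/
theorem isOpen_Jσ : IsOpen Jσ := isOpen_Ioo

/-- `Tq ⊆ N₃`. [folklore] -/
theorem Tq_subset_N₃ : D.Tq ⊆ D.N₃ := D.T_subset_N₃ _

/-- The surface lies in `Tq`. [folklore] -/
theorem b_mem_Tq (y : S) : D.b y ∈ D.Tq := D.b_mem_T (by linarith [D.εc_pos]) y

/-- The surface lies in `Tq`. [folklore] -/
theorem range_b_subset_Tq : range D.b ⊆ D.Tq := by
  rintro _ ⟨y, rfl⟩; exact D.b_mem_Tq y

/-- `Jσ` is star-shaped at `0`. [folklore] -/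
theorem mul_mem_Jσ {s : ℝ} (hs : s ∈ Jσ) {σ : ℝ} (hσ : σ ∈ Icc (0 : ℝ) 1) : σ * s ∈ Jσ := by
  obtain ⟨h1, h2⟩ := hs
  obtain ⟨h3, h4⟩ := hσ
  constructor <;> nlinarith

/-- `0 ∈ Jσ`. [folklore] -/
theorem zero_mem_Jσ : (0 : ℝ) ∈ Jσ := by constructor <;> norm_num [Jσ]

/-- `1 ∈ Jσ`. [folklore] -/
theorem one_mem_Jσ : (1 : ℝ) ∈ Jσ := by constructor <;> norm_num [Jσ]

/-- `[0, 1] ⊆ Jσ`. [folklore] -/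
theorem Icc_subset_Jσ : Icc (0 : ℝ) 1 ⊆ Jσ := fun σ hσ ↦ ⟨by linarith [hσ.1], by linarith [hσ.2]⟩

/-- `|σ| < 3/2` on `Jσ`. [folklore] -/
theorem abs_lt_of_mem_Jσ {σ : ℝ} (hσ : σ ∈ Jσ) : |σ| < 3 / 2 := abs_lt.2 hσ

/-- On the quarter tube `‖nrm x‖ < ρ0 / 2`. [folklore] -/
theorem norm_nrm_lt_of_mem_Tq {x : N} (hx : x ∈ D.Tq) : ‖D.nrm x‖ < D.ρ0 / 2 := by
  have h : D.K (D.π₁ x) * ‖D.nrm x‖ ^ 2 < D.εc / 4 := hx.2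
  have h1 : D.Kmin * ‖D.nrm x‖ ^ 2 ≤ D.K (D.π₁ x) * ‖D.nrm x‖ ^ 2 :=
    mul_le_mul_of_nonneg_right (D.Kmin_le _) (sq_nonneg _)
  have h2 : ‖D.nrm x‖ ^ 2 < (D.ρ0 / 2) ^ 2 := by
    have : D.Kmin * ‖D.nrm x‖ ^ 2 < D.Kmin * (D.ρ0 / 2) ^ 2 := by
      have hε : D.εc / 4 = D.Kmin * (D.ρ0 / 2) ^ 2 := by rw [εc]; ring
      linarith
    exact lt_of_mul_lt_mul_left this D.Kmin_pos.le
  exact (sq_lt_sq₀ (norm_nonneg _) (by linarith [D.ρ0_pos])).1 h2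

/-- **The scaled normal vectors stay short**: `‖σ • nrm x‖ < 3 ρ0 / 4` for `x ∈ Tq`, `σ ∈ Jσ`.
[folklore] -/
theorem norm_smul_nrm_lt {x : N} (hx : x ∈ D.Tq) {σ : ℝ} (hσ : σ ∈ Jσ) :
    ‖σ • D.nrm x‖ < 3 * D.ρ0 / 4 := by
  rw [norm_smul, Real.norm_eq_abs]
  have h1 := abs_lt_of_mem_Jσ hσ
  have h2 := D.norm_nrm_lt_of_mem_Tq hx
  have h3 : |σ| * ‖D.nrm x‖ ≤ 3 / 2 * ‖D.nrm x‖ := mul_le_mul_of_nonneg_right h1.le (norm_nonneg _)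
  have h4 : 3 / 2 * ‖D.nrm x‖ < 3 / 2 * (D.ρ0 / 2) := by
    exact mul_lt_mul_of_pos_left h2 (by norm_num)
  linarith

/-- `‖σ • nrm x‖ < ρ0` for `x ∈ Tq`, `σ ∈ Jσ`. [folklore] -/
theorem norm_smul_nrm_lt_ρ0 {x : N} (hx : x ∈ D.Tq) {σ : ℝ} (hσ : σ ∈ Jσ) :
    ‖σ • D.nrm x‖ < D.ρ0 := by
  have := D.norm_smul_nrm_lt hx hσ
  linarith [D.ρ0_pos]

/-! ### The cover chart of a point of the quarter tube -/

/-- The index of an atlas chart whose base patch contains `y`. [folklore] -/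
def coverIdx (y : S) : Fin D.atlas.k := (D.atlas.cover y).choose

/-- `y` lies in the base patch of its cover chart. [folklore] -/
theorem mem_basePatch_coverIdx (y : S) : y ∈ D.basePatch (D.atlas.chart (D.coverIdx y)) :=
  (D.atlas.cover y).choose_spec

/-- **A point of the quarter tube lies in the domain of the cover chart of its foot.** [folklore] -/
theorem mem_O_coverIdx {x : N} (hx : x ∈ D.Tq) : x ∈ (D.atlas.chart (D.coverIdx (D.π₁ x))).O := by
  set i := D.coverIdx (D.π₁ x)
  have hρ : ‖D.nrm x‖ < (D.atlas.chart i).ρ := by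
    have := D.norm_nrm_lt_of_mem_Tq hx
    linarith [D.ρ0_le i, D.ρ0_pos]
  obtain ⟨x', hx', heq⟩ := D.exists_mem_O_Θ_eq i (D.mem_basePatch_coverIdx (D.π₁ x)) (D.nrm_mem_F x) hρ
  have : x' = x := D.injOn_Θ ((D.atlas.chart i).O_subset_N₂ hx') (D.N₃_subset_N₂ (D.Tq_subset_N₃ hx)) heq
  rw [← this]; exact hx'

/-! ### The fibre scaling -/

/-- **The fibre scaling** `Sc (x, σ) = Λ (π₁ x, σ • nrm x)`: the linear homotopy of the tube onto
the surface along the fibres (meaningful on `Tq × Jσ`). [cite: McDuffSalamon2017, Lemma 3.2.1] -/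
def Sc (p : N × ℝ) : N := D.Λ (D.π₁ p.1, p.2 • D.nrm p.1)

/-- **Defining property**: `Sc (x, σ) ∈ N₃` and `Θ (Sc (x, σ)) = (π₁ x, σ • nrm x)` on `Tq × Jσ`.
[folklore] -/
theorem Sc_spec {x : N} (hx : x ∈ D.Tq) {σ : ℝ} (hσ : σ ∈ Jσ) :
    D.Sc (x, σ) ∈ D.N₃ ∧ D.Θ (D.Sc (x, σ)) = (D.π₁ x, σ • D.nrm x) := by
  obtain ⟨x', hx', h⟩ := D.exists_mem_N₃_Θ_eq ((D.F _).smul_mem σ (D.nrm_mem_F x))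
    (D.norm_smul_nrm_lt_ρ0 hx hσ)
  have hSc : D.Sc (x, σ) = x' := by rw [Sc, ← h, D.Λ_Θ hx']
  rw [hSc]
  exact ⟨hx', h⟩

/-- `Sc (x, σ) ∈ N₃`. [folklore] -/
theorem Sc_mem_N₃ {x : N} (hx : x ∈ D.Tq) {σ : ℝ} (hσ : σ ∈ Jσ) : D.Sc (x, σ) ∈ D.N₃ :=
  (D.Sc_spec hx hσ).1

/-- `π₁ (Sc (x, σ)) = π₁ x`. [folklore] -/
theorem π₁_Sc {x : N} (hx : x ∈ D.Tq) {σ : ℝ} (hσ : σ ∈ Jσ) : D.π₁ (D.Sc (x, σ)) = D.π₁ x :=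
  congrArg Prod.fst (D.Sc_spec hx hσ).2

/-- `nrm (Sc (x, σ)) = σ • nrm x`. [folklore] -/
theorem nrm_Sc {x : N} (hx : x ∈ D.Tq) {σ : ℝ} (hσ : σ ∈ Jσ) : D.nrm (D.Sc (x, σ)) = σ • D.nrm x :=
  congrArg Prod.snd (D.Sc_spec hx hσ).2

/-- **`Sc (x, 1) = x`** on `N₃`. [folklore] -/
theorem Sc_one {x : N} (hx : x ∈ D.N₃) : D.Sc (x, 1) = x := by
  rw [Sc]
  show D.Λ (D.π₁ x, (1 : ℝ) • D.nrm x) = x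
  rw [one_smul, ← D.Θ_apply x, D.Λ_Θ hx]

/-- **`Sc (x, 0) = b (π₁ x)`**: the scaling retracts onto the surface. [folklore] -/
theorem Sc_zero (x : N) : D.Sc (x, 0) = D.b (D.π₁ x) := by
  rw [Sc]
  show D.Λ (D.π₁ x, (0 : ℝ) • D.nrm x) = D.b (D.π₁ x)
  rw [zero_smul, ← D.Θ_b, D.Λ_Θ (D.b_mem_N₃ _)]

/-- **The surface is fixed**: `Sc (b y, σ) = b y`. [folklore] -/
theorem Sc_b (y : S) (σ : ℝ) : D.Sc (D.b y, σ) = D.b y := by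
  rw [Sc]
  show D.Λ (D.π₁ (D.b y), σ • D.nrm (D.b y)) = D.b y
  rw [D.nrm_b, smul_zero, D.π₁_b, ← D.Θ_b, D.Λ_Θ (D.b_mem_N₃ _)]

/-- `ρ2 (Sc (x, σ)) = σ² ρ2 x`. [folklore] -/
theorem ρ2_Sc {x : N} (hx : x ∈ D.Tq) {σ : ℝ} (hσ : σ ∈ Jσ) : D.ρ2 (D.Sc (x, σ)) = σ ^ 2 * D.ρ2 x := by
  rw [D.ρ2_apply, D.ρ2_apply, D.π₁_Sc hx hσ, D.nrm_Sc hx hσ, norm_smul, mul_pow, Real.norm_eq_abs,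
    sq_abs]
  ring

/-- The scaling does not increase `ρ2` for `|σ| ≤ 1`. [folklore] -/
theorem ρ2_Sc_le {x : N} (hx : x ∈ D.Tq) {σ : ℝ} (hσ : σ ∈ Jσ) (h1 : |σ| ≤ 1) :
    D.ρ2 (D.Sc (x, σ)) ≤ D.ρ2 x := by
  rw [D.ρ2_Sc hx hσ]
  have hσ2 : σ ^ 2 ≤ 1 := by
    have := abs_le.1 h1
    nlinarith
  nlinarith [D.ρ2_nonneg x]

/-- The quarter tube is invariant under the scalings with `|σ| ≤ 1`. [folklore] -/
theorem Sc_mem_Tq {x : N} (hx : x ∈ D.Tq) {σ : ℝ} (hσ : σ ∈ Jσ) (h1 : |σ| ≤ 1) :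
    D.Sc (x, σ) ∈ D.Tq :=
  ⟨D.Sc_mem_N₃ hx hσ, (D.ρ2_Sc_le hx hσ h1).trans_lt hx.2⟩

/-! ### The scaling in the box charts; smoothness -/

/-- **In a box chart the scaling is `(q, z) ↦ (q, σ z)`**: for `x ∈ N₃ ∩ O` and
`‖σ • z‖ < ρ` (`Ξ x = (q, z)`), `(q, σ z)` lies in the box and `Sc (x, σ) = inv (q, σ z)`,
provided `(x, σ) ∈ Tq × Jσ`. [folklore] -/
theorem Sc_eq_inv {y₀ : S} (B : D.BoxChart y₀) {x : N} (hx : x ∈ D.Tq) (hxO : x ∈ B.O) {σ : ℝ}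
    (hσ : σ ∈ Jσ) (hσz : ‖σ • (D.Ξ y₀ B.c x).2‖ < B.ρ) :
    ((D.Ξ y₀ B.c x).1, σ • (D.Ξ y₀ B.c x).2) ∈ B.box ∧
      D.Sc (x, σ) = B.inv ((D.Ξ y₀ B.c x).1, σ • (D.Ξ y₀ B.c x).2) := by
  have hbox := B.Ξ_mem_box hxO
  have hp : ((D.Ξ y₀ B.c x).1, σ • (D.Ξ y₀ B.c x).2) ∈ B.box := ⟨hbox.1, mem_ball_zero_iff.2 hσz⟩
  refine ⟨hp, D.injOn_Θ (D.N₃_subset_N₂ (D.Sc_mem_N₃ hx hσ)) (B.O_subset_N₂ (B.inv_mem_O hp)) ?_⟩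
  rw [(D.Sc_spec hx hσ).2, B.Θ_inv hp]
  have hΘx : D.Θ x = ((extChartAt (𝓡 2) y₀).symm (D.Ξ y₀ B.c x).1,
      D.Fr B.c ((extChartAt (𝓡 2) y₀).symm (D.Ξ y₀ B.c x).1) (D.Ξ y₀ B.c x).2) := by
    conv_lhs => rw [← B.inv_Ξ x hxO]
    exact B.Θ_inv hbox
  have h1 : D.π₁ x = (extChartAt (𝓡 2) y₀).symm (D.Ξ y₀ B.c x).1 := congrArg Prod.fst hΘx
  have h2 : D.nrm x = D.Fr B.c ((extChartAt (𝓡 2) y₀).symm (D.Ξ y₀ B.c x).1) (D.Ξ y₀ B.c x).2 :=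
    congrArg Prod.snd hΘx
  show (D.π₁ x, σ • D.nrm x) = _
  rw [h2, ← h1, map_smul]

/-- The chart-scaling domain of chart `i`: points of `Oᵢ ∩ Tq` and scalars in `Jσ` keeping the
scaled fibre coordinate in the box. [folklore] -/
def scDom (i : Fin D.atlas.k) : Set (N × ℝ) :=
  (((D.atlas.chart i).O ∩ D.Tq) ×ˢ Jσ) ∩
    (fun p : N × ℝ ↦ ‖p.2 • (D.Ξ (D.atlas.yc i) (D.atlas.chart i).c p.1).2‖) ⁻¹'
      Iio (D.atlas.chart i).ρ

/-- The scaled fibre coordinate is continuous on `(Oᵢ ∩ Tq) × Jσ`. [folklore] -/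
theorem continuousOn_smul_Ξ (i : Fin D.atlas.k) :
    ContinuousOn (fun p : N × ℝ ↦ ‖p.2 • (D.Ξ (D.atlas.yc i) (D.atlas.chart i).c p.1).2‖)
      (((D.atlas.chart i).O ∩ D.Tq) ×ˢ Jσ) := by
  have hΞ : ContinuousOn (fun p : N × ℝ ↦ D.Ξ (D.atlas.yc i) (D.atlas.chart i).c p.1)
      (((D.atlas.chart i).O ∩ D.Tq) ×ˢ Jσ) :=
    (D.atlas.chart i).contMDiffOn_Ξ.continuousOn.comp continuous_fst.continuousOn fun p hp ↦ hp.1.1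
  exact (continuous_snd.continuousOn.smul (continuous_snd.comp_continuousOn hΞ)).norm

/-- The chart-scaling domains are open. [folklore] -/
theorem isOpen_scDom (i : Fin D.atlas.k) : IsOpen (D.scDom i) :=
  (D.continuousOn_smul_Ξ i).isOpen_inter_preimage
    (((D.atlas.chart i).isOpen_O.inter D.isOpen_Tq).prod isOpen_Jσ) isOpen_Iio

/-- A point of `Tq × Jσ` lies in the chart-scaling domain of the cover chart of its foot.
[folklore] -/
theorem mem_scDom_coverIdx {p : N × ℝ} (hp : p ∈ D.Tq ×ˢ Jσ) :
    p ∈ D.scDom (D.coverIdx (D.π₁ p.1)) := by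
  set i := D.coverIdx (D.π₁ p.1)
  have hO : p.1 ∈ (D.atlas.chart i).O := D.mem_O_coverIdx hp.1
  refine ⟨⟨⟨hO, hp.1⟩, hp.2⟩, ?_⟩
  show ‖p.2 • (D.Ξ (D.atlas.yc i) (D.atlas.chart i).c p.1).2‖ < (D.atlas.chart i).ρ
  rw [norm_smul, ← (D.atlas.chart i).norm_nrm hO, ← norm_smul]
  exact (D.norm_smul_nrm_lt_ρ0 hp.1 hp.2).trans_le (D.ρ0_le i)

/-- **The scaling is smooth on each chart-scaling domain** (it is `(q, z) ↦ (q, σ z)` there).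
[folklore] -/
theorem contMDiffOn_Sc_scDom (i : Fin D.atlas.k) :
    ContMDiffOn ((𝓡 4).prod 𝓘(ℝ, ℝ)) (𝓡 4) ∞ D.Sc (D.scDom i) := by
  set B := D.atlas.chart i
  have heq : EqOn D.Sc
      (fun p : N × ℝ ↦ B.inv ((D.Ξ (D.atlas.yc i) B.c p.1).1, p.2 • (D.Ξ (D.atlas.yc i) B.c p.1).2))
      (D.scDom i) := by
    rintro ⟨x, σ⟩ ⟨⟨⟨hxO, hx⟩, hσ⟩, hρ⟩
    exact (D.Sc_eq_inv B hx hxO hσ hρ).2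
  have hΞ : ContMDiffOn ((𝓡 4).prod 𝓘(ℝ, ℝ)) 𝓘(ℝ, E2 × E2) ∞
      (fun p : N × ℝ ↦ D.Ξ (D.atlas.yc i) B.c p.1) (D.scDom i) :=
    B.contMDiffOn_Ξ.comp contMDiffOn_fst fun p hp ↦ hp.1.1.1
  have hg : ContMDiffOn ((𝓡 4).prod 𝓘(ℝ, ℝ)) 𝓘(ℝ, E2 × E2) ∞
      (fun p : N × ℝ ↦ ((D.Ξ (D.atlas.yc i) B.c p.1).1, p.2 • (D.Ξ (D.atlas.yc i) B.c p.1).2))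
      (D.scDom i) :=
    ((contDiff_fst (𝕜 := ℝ) (E := E2) (F := E2)).contMDiff.comp_contMDiffOn hΞ).prodMk_space
      (contMDiffOn_snd.smul ((contDiff_snd (𝕜 := ℝ) (E := E2) (F := E2)).contMDiff.comp_contMDiffOn hΞ))
  have hmaps : MapsTo
      (fun p : N × ℝ ↦ ((D.Ξ (D.atlas.yc i) B.c p.1).1, p.2 • (D.Ξ (D.atlas.yc i) B.c p.1).2))
      (D.scDom i) B.box := by
    rintro ⟨x, σ⟩ ⟨⟨⟨hxO, hx⟩, hσ⟩, hρ⟩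
    exact (D.Sc_eq_inv B hx hxO hσ hρ).1
  exact (B.contMDiffOn_inv.comp hg hmaps).congr heq

/-- **The fibre scaling is smooth on `Tq × Jσ`.** [cite: McDuffSalamon2017, Lemma 3.2.1] -/
theorem contMDiffOn_Sc : ContMDiffOn ((𝓡 4).prod 𝓘(ℝ, ℝ)) (𝓡 4) ∞ D.Sc (D.Tq ×ˢ Jσ) := by
  intro p hp
  have hmem := D.mem_scDom_coverIdx hp
  exact ((D.contMDiffOn_Sc_scDom _ p hmem).contMDiffAt ((D.isOpen_scDom _).mem_nhds hmem)).contMDiffWithinAt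

/-- The fibre scaling is smooth at the points of `Tq × Jσ`. [folklore] -/
theorem contMDiffAt_Sc {x : N} (hx : x ∈ D.Tq) {σ : ℝ} (hσ : σ ∈ Jσ) :
    ContMDiffAt ((𝓡 4).prod 𝓘(ℝ, ℝ)) (𝓡 4) ∞ D.Sc (x, σ) :=
  (D.contMDiffOn_Sc _ ⟨hx, hσ⟩).contMDiffAt
    (((D.isOpen_Tq.prod isOpen_Jσ).mem_nhds ⟨hx, hσ⟩))

/-- The fibre scaling is smooth near the points of `Tq × Jσ`. [folklore] -/
theorem eventually_contMDiffAt_Sc {x : N} (hx : x ∈ D.Tq) {σ : ℝ} (hσ : σ ∈ Jσ) :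
    ∀ᶠ p in 𝓝 ((x, σ) : N × ℝ), ContMDiffAt ((𝓡 4).prod 𝓘(ℝ, ℝ)) (𝓡 4) ∞ D.Sc p := by
  filter_upwards [(D.isOpen_Tq.prod isOpen_Jσ).mem_nhds ⟨hx, hσ⟩] with p hp
  exact D.contMDiffAt_Sc hp.1 hp.2

/-! ### Two differentials of the scaling -/

/-- **The vertical derivative of the scaling vanishes along the surface**:
`d(Sc)_{(b y, σ)} (0, 1) = 0` (the curve `σ ↦ Sc (b y, σ) = b y` is constant). [folklore] -/
theorem mfderiv_Sc_b_vertical (y : S) {σ : ℝ} (hσ : σ ∈ Jσ) :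
    mfderiv ((𝓡 4).prod 𝓘(ℝ, ℝ)) (𝓡 4) D.Sc (D.b y, σ)
      (((0 : EuclideanSpace ℝ (Fin 4)), (1 : ℝ)) : TangentSpace ((𝓡 4).prod 𝓘(ℝ, ℝ)) (D.b y, σ)) = 0 := by
  have hι : HasMFDerivAt 𝓘(ℝ, ℝ) ((𝓡 4).prod 𝓘(ℝ, ℝ)) (fun s : ℝ ↦ ((D.b y, s) : N × ℝ)) σ
      ((0 : TangentSpace 𝓘(ℝ, ℝ) σ →L[ℝ] TangentSpace (𝓡 4) (D.b y)).prod
        (ContinuousLinearMap.id ℝ (TangentSpace 𝓘(ℝ, ℝ) σ))) :=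
    (hasMFDerivAt_const (D.b y) σ).prodMk (hasMFDerivAt_id σ)
  have hSc : HasMFDerivAt ((𝓡 4).prod 𝓘(ℝ, ℝ)) (𝓡 4) D.Sc (D.b y, σ)
      (mfderiv ((𝓡 4).prod 𝓘(ℝ, ℝ)) (𝓡 4) D.Sc (D.b y, σ)) :=
    ((D.contMDiffAt_Sc (D.b_mem_Tq y) hσ).mdifferentiableAt (by simp)).hasMFDerivAt
  have hcomp := hSc.comp σ hι
  have hfun : (D.Sc ∘ fun s : ℝ ↦ ((D.b y, s) : N × ℝ)) = fun _ ↦ D.b y := funext fun s ↦ D.Sc_b y s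
  have hconst : HasMFDerivAt 𝓘(ℝ, ℝ) (𝓡 4) (D.Sc ∘ fun s : ℝ ↦ ((D.b y, s) : N × ℝ)) σ
      (0 : TangentSpace 𝓘(ℝ, ℝ) σ →L[ℝ]
        TangentSpace (𝓡 4) ((D.Sc ∘ fun s : ℝ ↦ ((D.b y, s) : N × ℝ)) σ)) := by
    rw [hfun]
    exact hasMFDerivAt_const _ _
  have heq := hcomp.mfderiv.symm.trans hconst.mfderiv
  have happ := congrArg (fun L : TangentSpace 𝓘(ℝ, ℝ) σ →L[ℝ]
      TangentSpace (𝓡 4) ((D.Sc ∘ fun s : ℝ ↦ ((D.b y, s) : N × ℝ)) σ) ↦ L (1 : ℝ)) heq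
  exact happ

/-- **`x ↦ Sc (x, 1)` is the identity near every point of `N₃`.** [folklore] -/
theorem eventuallyEq_Sc_one {x : N} (hx : x ∈ D.N₃) : (fun z ↦ D.Sc (z, 1)) =ᶠ[𝓝 x] id := by
  filter_upwards [D.isOpen_N₃.mem_nhds hx] with z hz
  exact D.Sc_one hz

/-- **`d(x ↦ Sc (x, 1)) = id` on `N₃`.** [folklore] -/
theorem mfderiv_Sc_one {x : N} (hx : x ∈ D.N₃) :
    mfderiv (𝓡 4) (𝓡 4) (fun z ↦ D.Sc (z, 1)) x = ContinuousLinearMap.id ℝ (TangentSpace (𝓡 4) x) := by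
  rw [(D.eventuallyEq_Sc_one hx).mfderiv_eq]
  exact mfderiv_id

end Setup

end SurfaceTube

end Literature.Geometry.Symplectic
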